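import Summits.CriticalPhenomena.PercolationContinuityZ3.Theorems.FK.PressureQDifferentiability
import HarnessLib

/-!
# FK-continuity cell, FO-10a: transport of the cluster-size events `{|C_x| ≥ k}` between a box and a
# translated smaller box — `φ⁰_{Λ_m}(|C_0| ≥ k) ≤ φ⁰_{Λ_N}(|C_x| ≥ k)` and `φ¹_{Λ_N}(|C_x| ≥ k) ≤ φ¹_{Λ_m}(|C_0| ≥ k)`
# for `x + Λ_m ⊆ Λ_N` (Grimmett 2006, Thm. (4.19)(a) proof, eq. (4.24), with the translations of §4.3)

Registered R109 (cell INBOX l.7500, 2026-08-25); registry row FO-10a-g341; label CCL-A (coordinator fk-4 g227).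
Cell `fk-continuity` (bschramm), row FO-10a (domain-Markov + comparison layer over FO-06); support file for the
FK-continuity transplant (`--supports stmt-CriticalPhenomena-4575`); builds on p205010 (kernel theorem, internal audit
signed; external expert review pending). Pure proofs; no definitions, no named facts, no sorries; general `d`.
UNCONDITIONAL finite-volume structure; it decides nothing about FH / TP_FK / the value of `p_c(q)`.

The "deep sites" device behind the two-sided thermodynamic limits of the mean number of clusters per site
(Grimmett's (4.81)–(4.83), companion files `BoxClusterCountFreeLimit.lean`, `BoxClusterCountWiredLimit.lean`): a site
`x ∈ Λ_N` with `x + Λ_m ⊆ Λ_N` sees, inside `Λ_N`, at least the free law and at most the wired law of its own translated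
box `x + Λ_m`, and the latter are the laws of `Λ_m` seen from the origin. For `0 ≤ p ≤ 1`, `q ≥ 1`, `‖x‖_∞ + m ≤ N`:

* `preimage_relabel_shift_clusterSizeGe` — `{|C_{x+v}| ≥ k}` pulls back to `{|C_x| ≥ k}` along the shift `ω ↦ ω + v`;
* `liftEdges_preimage_clusterSizeGe` — on the graph of a region `Λ`, `{|C_x| ≥ k}` is the pull-back of the `ℤ^d`-event;
* `box_map_shift_subset_box` — `Λ_m + x ⊆ Λ_N`; deep-site bookkeeping `card_filter_coe_mem_box_sub`
  (`#{x ∈ Λ_N : x ∈ Λ_{N−m}} = |Λ_{N−m}|`), `siteRad_add_le_of_mem_box_sub`, `sum_Icc_measureReal_div_le_one`;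
* **`rcBoxMeasure_false_real_clusterSizeGe_center_le`** — `φ⁰_{Λ_m,p,q}(|C_0| ≥ k) ≤ φ⁰_{Λ_N,p,q}(|C_x| ≥ k)`
  (free region laws increase with the region on increasing events, `regionFreeReal_mono`, plus the covariance
  `regionFreeReal_shift`);
* **`rcBoxMeasure_true_real_clusterSizeGe_le_center`** — `φ¹_{Λ_N,p,q}(|C_x| ≥ k) ≤ φ¹_{Λ_m,p,q}(|C_0| ≥ k)` for `k ≤ m`
  (wired region laws decrease with the region on increasing events determined inside the smaller region,
  `regionWiredReal_anti`, applied to the LOCAL proxy of `{|C_x| ≥ k}` of `ClusterSizeLocality.lean`);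
* `tendsto_rcBoxMeasure_real_clusterSizeGe_center` — `φ^b_{Λ_m,p,q}(|C_0| ≥ k) → φ^b_{p,q}(|C_0| ≥ k)` as `m → ∞`;
* geometry of small clusters: `mem_box_add_length_of_walk`, `openCluster_subset_box_add_of_ncard_le` (a cluster with at
  most `s + 1` vertices through `x ∈ Λ_m` lies in `Λ_{m+s}`) and **`disjoint_openCluster_boxBC_of_not_le_encard`** (in the
  box graph `Λ_N`, a cluster of `x` with fewer than `k` vertices, `‖x‖_∞ + k ≤ N + 1`, does not meet the wired boundary
  `∂Λ_N`).

## References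

* G. Grimmett, *The Random-Cluster Model*, Springer 2006 (`book:grimmett2006-random-cluster-model`): Thm. (4.19)(a),
  proof, eq. (4.24) p. 78; §4.3 (automorphisms of `ℤ^d`, translations `τ_x`) pp. 76–78; proof of Thm. (4.58),
  (4.81)–(4.83) [PDF p. 94]. [Grimmett2006]
-/

noncomputable section

open scoped Classical
open Finset Filter Topology MeasureTheory

namespace Summit.CriticalPhenomena.PercolationContinuityZ3.Theorems.FK

open Literature.Probability.Percolation Literature.Probability.LatticeModels

variable {d : ℕ}

/-! ### The events `{|C_x| ≥ k}` under shifts and lifts -/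

section Events

/-- `{|C_x| ≥ k}` is increasing. [folklore] -/
theorem isUpperSet_clusterSizeGe' {V : Type*} (x : V) (k : ℕ) : IsUpperSet (clusterSizeGe x k) :=
  fun _ _ h hω => le_trans hω (Set.encard_le_encard (openCluster_mono h x))

/-- **`{|C_{x+v}| ≥ k}` pulls back to `{|C_x| ≥ k}` along the shift `ω ↦ ω + v`** (`C_{ω+v}(x+v) = C_ω(x) + v`).
[cite: Grimmett2006, §4.3 (translations τ_x)] -/
theorem preimage_relabel_shift_clusterSizeGe (v x : Site d) (k : ℕ) :
    BondConfig.relabel (sym2Equiv (Site.shift v)) ⁻¹' clusterSizeGe (x + v) k = clusterSizeGe x k := by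
  ext ω
  rw [Set.mem_preimage, mem_clusterSizeGe, mem_clusterSizeGe]
  have h := openCluster_relabel (Site.shift v) ω x
  rw [Site.shift_apply] at h
  rw [h, (Site.shift v).injective.encard_image]

/-- On the graph of a finite region `Λ`, `{|C_x| ≥ k}` is the pull-back of the `ℤ^d`-event `{|C_x| ≥ k}` along
`liftEdges Λ`. [folklore] -/
theorem liftEdges_preimage_clusterSizeGe (Λ : Finset (Site d)) (x : ↥Λ) (k : ℕ) :
    liftEdges Λ ⁻¹' clusterSizeGe (x : Site d) k = clusterSizeGe x k := by
  ext ω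
  rw [Set.mem_preimage, mem_clusterSizeGe, mem_clusterSizeGe, encard_openCluster_liftEdges]

/-- `φ⁰_{Λ_N,p,q}(|C_x| ≥ k)` is the free region law of the `ℤ^d`-event. [cite: Grimmett2006, §4.2 (4.11)–(4.12)] -/
theorem rcBoxMeasure_false_real_clusterSizeGe_eq_regionFreeReal (p q : ℝ) (N : ℕ) (x : ↥(box d N)) (k : ℕ) :
    (rcBoxMeasure d false p q N).real (clusterSizeGe x k) =
      regionFreeReal d p q (box d N) (clusterSizeGe (x : Site d) k) := by
  rw [regionFreeReal, rcBoxMeasure_false, liftEdges_preimage_clusterSizeGe]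

/-- `φ¹_{Λ_N,p,q}(|C_x| ≥ k)` is the wired region law of the `ℤ^d`-event. [cite: Grimmett2006, §4.2 (4.11)–(4.12)] -/
theorem rcBoxMeasure_true_real_clusterSizeGe_eq_regionWiredReal (p q : ℝ) (N : ℕ) (x : ↥(box d N)) (k : ℕ) :
    (rcBoxMeasure d true p q N).real (clusterSizeGe x k) =
      regionWiredReal d p q (box d N) (clusterSizeGe (x : Site d) k) := by
  rw [regionWiredReal, rcBoxMeasure_true, liftEdges_preimage_clusterSizeGe]

/-- The region laws `φ^W_{Λ,p,q}` agree on `ℤ^d`-events that agree on lattice configurations.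
[cite: Grimmett2006, §1.2 eq. (1.2)] -/
theorem rcMeasure_region_real_congr_of_subset_edgeSet {p q : ℝ} (hp : p ∈ Set.Icc (0 : ℝ) 1) (hq : 0 < q)
    (Λ : Finset (Site d)) (W : Set ↥Λ) {A A' : Set (BondConfig (Site d))}
    (h : ∀ ω : BondConfig (Site d), ω ⊆ (zdGraph d).edgeSet → (ω ∈ A ↔ ω ∈ A')) :
    (rcMeasure (finsetGraph (zdGraph d) Λ) p q W).real (liftEdges Λ ⁻¹' A) =
      (rcMeasure (finsetGraph (zdGraph d) Λ) p q W).real (liftEdges Λ ⁻¹' A') := by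
  rw [← rcMeasure_region_real_preimage_inter_edgeSet hp hq Λ W A,
    ← rcMeasure_region_real_preimage_inter_edgeSet hp hq Λ W A']
  have hAA' : (fun ω : BondConfig (Site d) => ω ∩ (zdGraph d).edgeSet) ⁻¹' A =
      (fun ω : BondConfig (Site d) => ω ∩ (zdGraph d).edgeSet) ⁻¹' A' := by
    ext ω
    exact h _ Set.inter_subset_right
  rw [hAA']

/-- `Λ_m + x ⊆ Λ_N` once `‖x‖_∞ + m ≤ N`. [folklore] -/
theorem box_map_shift_subset_box {m N : ℕ} {x : Site d} (hx : siteRad x + m ≤ N) :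
    (box d m).map (Site.shift x).toEmbedding ⊆ box d N := by
  intro y hy
  rw [Finset.mem_map_equiv, Site.shift_symm_apply, mem_box_iff_siteRad_le] at hy
  rw [mem_box_iff_siteRad_le]
  have h := siteRad_add_le (y - x) x
  rw [sub_add_cancel] at h
  omega

/-- `‖x‖_∞ ≤ N` for `x ∈ Λ_N` (radius form of membership). [folklore] -/
theorem siteRad_le_of_mem_box {N : ℕ} {x : Site d} (hx : x ∈ box d N) : siteRad x ≤ N :=
  mem_box_iff_siteRad_le.1 hx

/-- The deep sites of `Λ_N`: `#{x ∈ Λ_N : x ∈ Λ_{N−m}} = |Λ_{N−m}|`. [folklore] -/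
theorem card_filter_coe_mem_box_sub (m N : ℕ) :
    #(Finset.univ.filter fun x : ↥(box d N) => (x : Site d) ∈ box d (N - m)) = #(box d (N - m)) := by
  rw [← Finset.card_map ⟨Subtype.val, Subtype.val_injective⟩]
  congr 1
  ext y
  simp only [Finset.mem_map, Finset.mem_filter, Finset.mem_univ, true_and, Function.Embedding.coeFn_mk]
  constructor
  · rintro ⟨x, hx, rfl⟩
    exact hx
  · intro hy
    exact ⟨⟨y, box_mono d (Nat.sub_le N m) hy⟩, hy, rfl⟩

/-- A deep site: `x ∈ Λ_{N−m}` with `m ≤ N` has `‖x‖_∞ + m ≤ N`. [folklore] -/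
theorem siteRad_add_le_of_mem_box_sub {m N : ℕ} (hmN : m ≤ N) {x : Site d} (hx : x ∈ box d (N - m)) :
    siteRad x + m ≤ N := by
  have h := mem_box_iff_siteRad_le.1 hx
  omega

/-- The truncated level sums are at most `1`: `Σ_{k=2}^{K} φ(|C_0| ≥ k)/((k−1)k) ≤ 1 − 1/K ≤ 1`. [folklore] -/
theorem sum_Icc_measureReal_div_le_one {α : Type*} [MeasurableSpace α] (μ : Measure α) [IsProbabilityMeasure μ]
    (A : ℕ → Set α) (K : ℕ) :
    ∑ k ∈ Finset.Icc 2 K, μ.real (A k) / (((k : ℝ) - 1) * k) ≤ 1 := by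
  rcases Nat.eq_zero_or_pos K with rfl | hK
  · simp
  calc ∑ k ∈ Finset.Icc 2 K, μ.real (A k) / (((k : ℝ) - 1) * k)
      ≤ ∑ k ∈ Finset.Icc 2 K, (1 : ℝ) / (((k : ℝ) - 1) * k) := by
        refine Finset.sum_le_sum fun k hk => ?_
        have hk2 : (2 : ℝ) ≤ k := by exact_mod_cast (Finset.mem_Icc.1 hk).1
        exact div_le_div_of_nonneg_right measureReal_le_one (by nlinarith)
    _ = 1 - 1 / K := sum_Icc_inv_mul_eq K hK
    _ ≤ 1 := by
        have : (0 : ℝ) ≤ 1 / K := by positivity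
        linarith

end Events

/-! ### Free: the centre of `Λ_m` sees at most what a deep site of `Λ_N` sees -/

section Free

variable {p q : ℝ}

/-- **`φ⁰_{Λ_m,p,q}(|C_0| ≥ k) ≤ φ⁰_{Λ_N,p,q}(|C_x| ≥ k)` for `x + Λ_m ⊆ Λ_N`** (`0 ≤ p ≤ 1`, `q ≥ 1`): the free law of
`Λ_m` is the free law of `x + Λ_m` seen from `x` (translation covariance), which lies below the free law of `Λ_N ⊇ x + Λ_m`
on the increasing event `{|C_x| ≥ k}` (Grimmett's (4.24)). [cite: Grimmett2006, Thm. (4.19)(a), proof, eq. (4.24); §4.3] -/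
theorem rcBoxMeasure_false_real_clusterSizeGe_center_le (hp : p ∈ Set.Icc (0 : ℝ) 1) (hq : 1 ≤ q) {m N : ℕ}
    (x : ↥(box d N)) (hx : siteRad (x : Site d) + m ≤ N) (k : ℕ) :
    (rcBoxMeasure d false p q m).real (clusterSizeGe (⟨0, zero_mem_box d m⟩ : ↥(box d m)) k) ≤
      (rcBoxMeasure d false p q N).real (clusterSizeGe x k) := by
  have hq0 : 0 < q := one_pos.trans_le hq
  rw [rcBoxMeasure_false_real_clusterSizeGe_eq_regionFreeReal,
    rcBoxMeasure_false_real_clusterSizeGe_eq_regionFreeReal]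
  have h0 : clusterSizeGe ((⟨0, zero_mem_box d m⟩ : ↥(box d m)) : Site d) k =
      BondConfig.relabel (sym2Equiv (Site.shift (x : Site d))) ⁻¹' clusterSizeGe (x : Site d) k := by
    rw [← preimage_relabel_shift_clusterSizeGe (x : Site d) 0 k, zero_add]
  rw [h0, regionFreeReal_shift (x : Site d) hp hq0]
  exact regionFreeReal_mono hp hq (box_map_shift_subset_box hx) (isUpperSet_clusterSizeGe' _ _)

end Free

/-! ### Wired: a deep site of `Λ_N` sees at most what the centre of `Λ_m` sees -/

section Wired

variable {p q : ℝ}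

/-- **`φ¹_{Λ_N,p,q}(|C_x| ≥ k) ≤ φ¹_{Λ_m,p,q}(|C_0| ≥ k)` for `x + Λ_m ⊆ Λ_N` and `k ≤ m`** (`0 ≤ p ≤ 1`, `q ≥ 1`): on
lattice configurations `{|C_x| ≥ k}` is decided by the edges of `x + Λ_k ⊆ x + Λ_m` (`ClusterSizeLocality`), the wired
law of `Λ_N` lies below the wired law of `x + Λ_m` on increasing events determined in `x + Λ_m` ((4.24) reversed,
`regionWiredReal_anti`), and the latter is the wired law of `Λ_m` seen from the origin.
[cite: Grimmett2006, Thm. (4.19)(a), proof, eq. (4.24); §4.3] -/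
theorem rcBoxMeasure_true_real_clusterSizeGe_le_center (hp : p ∈ Set.Icc (0 : ℝ) 1) (hq : 1 ≤ q) {m N : ℕ}
    (x : ↥(box d N)) (hx : siteRad (x : Site d) + m ≤ N) {k : ℕ} (hk : k ≤ m) :
    (rcBoxMeasure d true p q N).real (clusterSizeGe x k) ≤
      (rcBoxMeasure d true p q m).real (clusterSizeGe (⟨0, zero_mem_box d m⟩ : ↥(box d m)) k) := by
  have hq0 : 0 < q := one_pos.trans_le hq
  -- the centred local proxy `B` of `{|C_0| ≥ k}` and its translate `X` to `x`
  set B : Set (BondConfig (Site d)) :=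
    {ω | (k : ℕ∞) ≤ (openCluster (ω ∩ ↑(edgesIn (zdGraph d) (box d (0 + k)))) (0 : Site d)).encard} with hB
  have hBdet : DeterminedBy B ↑(edgesIn (zdGraph d) (box d (0 + k))) :=
    determinedBy_le_encard_openCluster_inter (0 : Site d) 0 k
  have hBup : IsUpperSet B := isUpperSet_le_encard_openCluster_inter (0 : Site d) 0 k
  have hBlat : ∀ ω : BondConfig (Site d), ω ⊆ (zdGraph d).edgeSet → (ω ∈ B ↔ ω ∈ clusterSizeGe (0 : Site d) k) :=
    fun ω hω => by
      rw [hB, Set.mem_setOf_eq, mem_clusterSizeGe, le_encard_openCluster_inter_edgesIn_iff hω (zero_mem_box d 0) k]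
  set T : Site d → BondConfig (Site d) → BondConfig (Site d) := fun v => BondConfig.relabel (sym2Equiv (Site.shift v))
    with hT
  set X : Set (BondConfig (Site d)) := T (-(x : Site d)) ⁻¹' B with hX
  -- `X` is increasing and determined inside `x + Λ_m`
  have hXup : IsUpperSet X := hBup.preimage (BondConfig.relabel_mono _)
  have hXdet : DeterminedBy X ↑(edgesIn (zdGraph d) ((box d m).map (Site.shift (x : Site d)).toEmbedding)) := by
    have h1 := determinedBy_preimage_relabel_shift hBdet (-(x : Site d))
    rw [neg_neg, edgesIn_map_shift] at h1
    refine h1.mono (Finset.coe_subset.2 (edgesIn_mono (zdGraph d) ?_))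
    exact Finset.map_subset_map.2 (box_mono d (by omega))
  -- `X` agrees with `{|C_x| ≥ k}` on lattice configurations
  have hXlat : ∀ ω : BondConfig (Site d), ω ⊆ (zdGraph d).edgeSet → (ω ∈ X ↔ ω ∈ clusterSizeGe (x : Site d) k) := by
    intro ω hω
    have hω' : T (-(x : Site d)) ω ⊆ (zdGraph d).edgeSet := (relabel_shift_subset_edgeSet_iff _ ω).2 hω
    rw [hX, Set.mem_preimage, hBlat _ hω', ← Set.mem_preimage,
      show (0 : Site d) = (x : Site d) + -(x : Site d) by rw [add_neg_cancel],
      preimage_relabel_shift_clusterSizeGe]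
  -- `T_x ⁻¹' X = B`: the shift by `-x` undoes the shift by `x`
  have hTX : T (x : Site d) ⁻¹' X = B := by
    rw [hX, ← Set.preimage_comp]
    have hsymm : Site.shift (-(x : Site d)) = (Site.shift (x : Site d)).symm :=
      Equiv.ext fun y => by rw [Site.shift_symm_apply, Site.shift_apply, sub_eq_add_neg]
    have hcomp : T (-(x : Site d)) ∘ T (x : Site d) = id := funext fun ω => by
      simp only [hT, Function.comp_apply, id_eq, hsymm]
      exact relabel_symm_relabel (Site.shift (x : Site d)) ω
    rw [hcomp, Set.preimage_id]
  -- the chain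
  calc (rcBoxMeasure d true p q N).real (clusterSizeGe x k)
      = regionWiredReal d p q (box d N) (clusterSizeGe (x : Site d) k) :=
        rcBoxMeasure_true_real_clusterSizeGe_eq_regionWiredReal p q N x k
    _ = regionWiredReal d p q (box d N) X :=
        (rcMeasure_region_real_congr_of_subset_edgeSet hp hq0 (box d N) _ hXlat).symm
    _ ≤ regionWiredReal d p q ((box d m).map (Site.shift (x : Site d)).toEmbedding) X :=
        regionWiredReal_anti hp hq (box_map_shift_subset_box hx) hXup hXdet
    _ = regionWiredReal d p q (box d m) (T (x : Site d) ⁻¹' X) := (regionWiredReal_shift (x : Site d) hp hq0 _ X).symm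
    _ = regionWiredReal d p q (box d m) B := by rw [hTX]
    _ = regionWiredReal d p q (box d m) (clusterSizeGe (0 : Site d) k) :=
        rcMeasure_region_real_congr_of_subset_edgeSet hp hq0 (box d m) _ hBlat
    _ = (rcBoxMeasure d true p q m).real (clusterSizeGe (⟨0, zero_mem_box d m⟩ : ↥(box d m)) k) :=
        (rcBoxMeasure_true_real_clusterSizeGe_eq_regionWiredReal p q m ⟨0, zero_mem_box d m⟩ k).symm

end Wired

/-! ### The limit at the centre: `φ^b_{Λ_m,p,q}(|C_0| ≥ k) → φ^b_{p,q}(|C_0| ≥ k)` -/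

section Limit

variable {p q : ℝ}

/-- `φ^b_{Λ_m,p,q}(|C_0| ≥ k)` in the box graph is the box law of the `ℤ^d`-event `{|C_0| ≥ k}`. [cite: Grimmett2006, §4.2] -/
theorem rcBoxMeasure_real_clusterSizeGe_eq_rcBoxLaw_real (b : Bool) (p q : ℝ) (m : ℕ) (x : ↥(box d m)) (k : ℕ) :
    (rcBoxMeasure d b p q m).real (clusterSizeGe x k) = (rcBoxLaw d b p q m).real (clusterSizeGe (x : Site d) k) := by
  rw [rcBoxLaw_real_apply b p q m (measurableSet_clusterSizeGe _ _), liftEdges_preimage_clusterSizeGe]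

/-- **`φ^b_{Λ_m,p,q}(|C_0| ≥ k) → φ^b_{p,q}(|C_0| ≥ k)` as `m → ∞`** (`0 ≤ p ≤ 1`, `q ≥ 1`, both boundary conditions):
under lattice-carried measures `{|C_0| ≥ k}` has the probability of its LOCAL proxy, on which the box laws converge.
[cite: Grimmett2006, Thm. (4.19)(a)] -/
theorem tendsto_rcBoxMeasure_real_clusterSizeGe_center (b : Bool) (hp : p ∈ Set.Icc (0 : ℝ) 1) (hq : 1 ≤ q) (k : ℕ) :
    Tendsto (fun m : ℕ => (rcBoxMeasure d b p q m).real (clusterSizeGe (⟨0, zero_mem_box d m⟩ : ↥(box d m)) k))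
      atTop (𝓝 ((rcLimit d b p q).real (clusterSizeGe (0 : Site d) k))) := by
  have hq0 : 0 < q := one_pos.trans_le hq
  set B : Set (BondConfig (Site d)) :=
    {ω | (k : ℕ∞) ≤ (openCluster (ω ∩ ↑(edgesIn (zdGraph d) (box d (0 + k)))) (0 : Site d)).encard} with hB
  have hBdet : DeterminedBy B ↑(edgesIn (zdGraph d) (box d (0 + k))) :=
    determinedBy_le_encard_openCluster_inter (0 : Site d) 0 k
  have hbox : ∀ m : ℕ, (rcBoxMeasure d b p q m).real (clusterSizeGe (⟨0, zero_mem_box d m⟩ : ↥(box d m)) k) =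
      (rcBoxLaw d b p q m).real B := fun m => by
    rw [rcBoxMeasure_real_clusterSizeGe_eq_rcBoxLaw_real,
      measureReal_clusterSizeGe_eq_of_ae_subset (ae_subset_edgeSet_rcBoxLaw b hp hq0 m) (zero_mem_box d 0) k]
  have hlim : (rcLimit d b p q).real (clusterSizeGe (0 : Site d) k) = (rcLimit d b p q).real B :=
    measureReal_clusterSizeGe_eq_of_ae_subset ((isBoxLimit_rcLimit b hp hq).ae_subset_edgeSet hp hq0) (zero_mem_box d 0) k
  simp_rw [hbox]
  rw [hlim]
  exact (isBoxLimit_rcLimit b hp hq).tendsto_real ⟨_, hBdet⟩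

end Limit

/-! ### Geometry: small clusters stay near their base point -/

section Geometry

/-- Along an open walk of length `ℓ` in a lattice configuration, a site of `Λ_m` reaches only `Λ_{m+ℓ}`. [folklore] -/
theorem mem_box_add_length_of_walk {ω : BondConfig (Site d)} (hω : ω ⊆ (zdGraph d).edgeSet) {x y : Site d}
    (w : (openGraph ω).Walk x y) {m : ℕ} (hx : x ∈ box d m) : y ∈ box d (m + w.length) := by
  induction w generalizing m with
  | nil => simpa using hx
  | @cons a b c hab w ih =>
    have hlat : (zdGraph d).Adj a b := by
      rw [openGraph_adj] at hab
      exact (SimpleGraph.mem_edgeSet _).1 (hω hab.1)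
    have hb : b ∈ box d (m + 1) := Literature.Probability.LatticeModels.mem_box_succ_of_adj hlat hx
    have h := ih hb
    rw [SimpleGraph.Walk.length_cons]
    simpa [Nat.add_assoc, Nat.add_comm 1] using h

/-- **A finite open cluster with at most `s + 1` vertices through `x ∈ Λ_m` lies in `Λ_{m+s}`** (lattice
configurations): every vertex of the cluster is the end of an open PATH from `x`, whose `≤ s + 1` distinct vertices lie in
the cluster. [folklore] -/
theorem openCluster_subset_box_add_of_ncard_le {ω : BondConfig (Site d)} (hω : ω ⊆ (zdGraph d).edgeSet) {m s : ℕ}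
    {x : Site d} (hx : x ∈ box d m) (hfin : (openCluster ω x).Finite) (hcard : (openCluster ω x).ncard ≤ s + 1) :
    openCluster ω x ⊆ ↑(box d (m + s)) := by
  intro y hy
  obtain ⟨w⟩ := (hy : (openGraph ω).Reachable x y)
  set P := w.bypass with hP
  have hpath : P.IsPath := w.bypass_isPath
  have hsupp : ∀ u ∈ P.support, u ∈ openCluster ω x := fun u hu => ⟨P.takeUntil u hu⟩
  have hlen : P.length ≤ s := by
    have h1 : P.support.length = P.length + 1 := P.length_support
    have h2 : P.support.toFinset.card = P.support.length := List.toFinset_card_of_nodup hpath.support_nodup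
    have h3 : P.support.toFinset ⊆ hfin.toFinset := fun u hu =>
      hfin.mem_toFinset.2 (hsupp u (List.mem_toFinset.1 hu))
    have h4 := Finset.card_le_card h3
    rw [← Set.ncard_eq_toFinset_card _ hfin] at h4
    omega
  exact Finset.mem_coe.2 (box_mono d (by omega) (mem_box_add_length_of_walk hω P hx))

/-- **In the box graph `Λ_N`, a cluster of `x` with fewer than `k` vertices does not meet the wired boundary `∂Λ_N`
when `‖x‖_∞ + k ≤ N + 1`.** [cite: Grimmett2006, proof of Thm. (4.58) (clusters not touching ∂Λ)] -/
theorem disjoint_openCluster_boxBC_of_not_le_encard {N k : ℕ} {ω : BondConfig ↥(box d N)}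
    (hω : ω ⊆ (finsetGraph (zdGraph d) (box d N)).edgeSet) (x : ↥(box d N)) (hx : siteRad (x : Site d) + k ≤ N + 1)
    (hk : ¬ (k : ℕ∞) ≤ (openCluster ω x).encard) : Disjoint (openCluster ω x) (boxBC d true N) := by
  -- the lifted cluster is finite with fewer than `k` vertices
  have hlat : liftEdges (box d N) ω ⊆ (zdGraph d).edgeSet := liftEdges_subset_edgeSet hω
  have hlt : (openCluster (liftEdges (box d N) ω) (x : Site d)).encard < k := by
    rw [encard_openCluster_liftEdges]; exact not_le.1 hk
  have hfin : (openCluster (liftEdges (box d N) ω) (x : Site d)).Finite :=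
    Set.finite_of_encard_le_coe (hlt.le)
  have hpos : 1 ≤ (openCluster (liftEdges (box d N) ω) (x : Site d)).ncard := by
    rw [Nat.one_le_iff_ne_zero, Ne, Set.ncard_eq_zero hfin]
    exact Set.nonempty_iff_ne_empty.1 ⟨(x : Site d), mem_openCluster_self _ _⟩
  have hncard : (openCluster (liftEdges (box d N) ω) (x : Site d)).ncard < k := by
    have h := hfin.cast_ncard_eq ▸ hlt
    exact_mod_cast h
  -- hence it lies in `x`'s box of radius `‖x‖ + (k - 2) ≤ N - 1`
  have hsub := openCluster_subset_box_add_of_ncard_le hlat (s := k - 2)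
    (mem_box_iff_siteRad_le.2 (le_refl (siteRad (x : Site d)))) hfin (by omega)
  refine Set.disjoint_left.2 fun y hy hyB => ?_
  have hyB' : (y : Site d) ∈ innerBoundary (zdGraph d) (box d N) := by simpa [boxBC] using hyB
  rw [mem_innerBoundary_iff] at hyB'
  obtain ⟨-, z, hz, hyz⟩ := hyB'
  have hy' : (y : Site d) ∈ openCluster (liftEdges (box d N) ω) (x : Site d) := by
    rw [openCluster_liftEdges_eq_image]; exact ⟨y, hy, rfl⟩
  have hybox : (y : Site d) ∈ box d (siteRad (x : Site d) + (k - 2)) := hsub hy'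
  have hzbox : z ∈ box d (siteRad (x : Site d) + (k - 2) + 1) :=
    Literature.Probability.LatticeModels.mem_box_succ_of_adj hyz hybox
  exact hz (box_mono d (by omega) hzbox)

end Geometry

end Summit.CriticalPhenomena.PercolationContinuityZ3.Theorems.FK

end
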